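import Mathlib
import HarnessLib
import Summits.Ventures.LatticeQCDFlow.Scoring.RegenerativeTourCovarianceSq
import Summits.Ventures.LatticeQCDFlow.Scoring.TourVarianceGeneral

/-!
# The regenerative VARIANCE estimator, I (oracle centring): `(1/R) Σ_{i=1}^R Z_i²` estimates the tour
# variance `v = E_ν̂[Z_0²]` with `P(|·− v| ≥ a) ≤ 24 (2C)⁴/(ε⁴ a² R)`, and `ε v` IS the asymptotic variance

HONEST FRAMING: exact (Metropolis-corrected) sampling algorithms for lattice gauge theory;
figures of merit are autocorrelation/cost numbers at stated couplings and volumes; no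
continuum-physics claim.

Venture `LatticeQCDFlow` (cell pub-lqcd), topic `Scoring`; FANOUT row 8 (`s0-cpn-nemc`, GEN-17).
NEW WORK of the cell, not a published result; no definition is introduced.  Notation of
`Scoring/RegenerativeEstimator.lean`: tours `1, …, R` of the split chain from ANY start,
`Z_i = ∑' u, 1{K_u = i} (f(X_u) − π(f))` the centred tour sums, `v := E_{P̂_ν̂}[Z_0²]` the tour variance
of the fresh chain.  The CLT-free certificates of GEN-16 use the crude bound `v ≤ (2C)²(2−ε)/ε²`; the
CLT-scale error bar of the regenerative method (Mykland–Tierney–Yu) instead ESTIMATES `v` from the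
same tours.  This file certifies the oracle-centred version of that estimator: the squared centred
tour sums `Z_1², Z_2², …` have mean `v`, are pairwise UNCORRELATED (`Scoring/RegenerativeTourCovarianceSq.lean`)
and have variance at most their fourth moment `≤ (2C)⁴ · 24/ε⁴` (`Scoring/SplitChainTourFourthMoment.lean`),
so Chebyshev gives `P(|(1/R) Σ_{i=1}^R Z_i² − v| ≥ a) ≤ 24 (2C)⁴/(ε⁴ a² R)` from any start; and by
`Scoring/TourVarianceGeneral.lean` the target `ε v` is EXACTLY the Green–Kubo asymptotic variance
`σ²_f = Var_π f + 2 Σ_{k≥1} C_f(k)`, for every minorising law `ν` — so `(ε/R) Σ Z_i²` is a consistent,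
CLT-free-certified estimator of `σ²_f` (oracle version: centred at the unknown `π(f)`; the plug-in
version centred at the tour estimate is the next file).  Printed counterpart NAMED ONLY: the
regenerative variance estimator and its consistency (Mykland–Tierney–Yu 1995 §3; Hobert–Jones–
Presnell–Rosenthal 2002 Thm 2; Jones–Haran–Caffo–Neath 2006) — nothing is cited as a fact.

## Content (`e = ε.toReal`; `0 < ε < 1`; any initial law; `|f| ≤ C` measurable; `R ≥ 1`, `a > 0`)

* **`splitChain_sqCentredTourSum_uncorrelated`** — `W_i = Z_{i+1}² − v`: `W_i W_{i'}` integrable,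
  `E[W_i W_{i'}] = 0` (`i ≠ i'`), `E[W_i²] ≤ (2C)⁴ · 24/e⁴`;
* **`regenerative_variance_oracle_confidence`** —
  `P(a ≤ |(Σ_{i<R} Z_{i+1}²)/R − v|) ≤ (2C)⁴ · 24/(e⁴ a² R)`;
* **`regenerative_asymptoticVariance_oracle_confidence`** — `π` invariant:
  `P(a ≤ |e (Σ_{i<R} Z_{i+1}²)/R − σ²_f|) ≤ (2C)⁴ · 24/(e² a² R)` with
  `σ²_f = ∫ f̄² dπ + 2 ∑' k, ∫ f̄ (kop κ)^[k+1] f̄ dπ`.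

NOT CLAIMED: the plug-in estimator (next file); optimal constants; a CLT; any `ε` of ours.
-/

noncomputable section

namespace Summit.Ventures.LatticeQCDFlow.Scoring

open MeasureTheory ProbabilityTheory Filter Finset Preorder Literature.Probability.MarkovChains
open scoped ENNReal

section Oracle

variable {Ω : Type*} [MeasurableSpace Ω]
  {κ : Kernel Ω Ω} [IsMarkovKernel κ] {ν : Measure Ω} [IsProbabilityMeasure ν] {ε : ℝ≥0∞}
  {hmin : ∀ x {B : Set Ω}, MeasurableSet B → ε * ν B ≤ κ x B}
  (κs : Kernel (Ω × Bool) (Ω × Bool)) [IsMarkovKernel κs]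
  (μs : Measure (Ω × Bool)) [IsProbabilityMeasure μs]

/-- **SQUARED CENTRED TOUR SUMS: MEAN `v`, UNCORRELATED, VARIANCE `≤ (2C)⁴ · 24/e⁴`.**  With
`v = E_{P̂_ν̂}[Z_0²]` and `W_i = Z_{i+1}² − v` (any probability law `π` as the centring, any start):
`W_i W_{i'}` is integrable, `E[W_i W_{i'}] = 0` for `i ≠ i'`, and `E[W_i²] ≤ (2C)⁴ · 24/e⁴`. -/
theorem splitChain_sqCentredTourSum_uncorrelated {π : Measure Ω} [IsProbabilityMeasure π]
    (hε0 : 0 < ε) (hε : ε < 1)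
    (hκs : ∀ p, κs p = (ε • ν).map (fun y : Ω => (y, true))
      + ((1 - ε) • Doeblin.residualKernel κ ν ε hmin p.1).map (fun y : Ω => (y, false)))
    {f : Ω → ℝ} (hf : Measurable f) {C : ℝ} (hC : ∀ x, |f x| ≤ C) (i i' : ℕ) :
    Integrable (fun x : ℕ → Ω × Bool =>
        ((∑' u, (if (∑ s ∈ Finset.range u, (if (x (s + 1)).2 then (1 : ℕ) else 0)) = i + 1
          then (1 : ℝ) else 0) * (f (x u).1 - ∫ z, f z ∂π)) ^ 2
          - ∫ y, (∑' u, (if (∑ s ∈ Finset.range u, (if (y (s + 1)).2 then (1 : ℕ) else 0)) = 0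
            then (1 : ℝ) else 0) * (f (y u).1 - ∫ z, f z ∂π)) ^ 2
            ∂(Kernel.trajMeasure (X := fun _ : ℕ => Ω × Bool) (ν.map (fun y : Ω => (y, true)))
              (fun n : ℕ => κs.comap (fun h : (i : ↥(Finset.Iic n)) → Ω × Bool =>
                h ⟨n, Finset.mem_Iic.2 le_rfl⟩) (measurable_pi_apply _))))
        * ((∑' u, (if (∑ s ∈ Finset.range u, (if (x (s + 1)).2 then (1 : ℕ) else 0)) = i' + 1
          then (1 : ℝ) else 0) * (f (x u).1 - ∫ z, f z ∂π)) ^ 2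
          - ∫ y, (∑' u, (if (∑ s ∈ Finset.range u, (if (y (s + 1)).2 then (1 : ℕ) else 0)) = 0
            then (1 : ℝ) else 0) * (f (y u).1 - ∫ z, f z ∂π)) ^ 2
            ∂(Kernel.trajMeasure (X := fun _ : ℕ => Ω × Bool) (ν.map (fun y : Ω => (y, true)))
              (fun n : ℕ => κs.comap (fun h : (i : ↥(Finset.Iic n)) → Ω × Bool =>
                h ⟨n, Finset.mem_Iic.2 le_rfl⟩) (measurable_pi_apply _)))))
      (Kernel.trajMeasure (X := fun _ : ℕ => Ω × Bool) μs
        (fun n : ℕ => κs.comap (fun h : (i : ↥(Finset.Iic n)) → Ω × Bool =>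
          h ⟨n, Finset.mem_Iic.2 le_rfl⟩) (measurable_pi_apply _)))
    ∧ (i ≠ i' → ∫ x, ((∑' u, (if (∑ s ∈ Finset.range u, (if (x (s + 1)).2 then (1 : ℕ) else 0))
          = i + 1 then (1 : ℝ) else 0) * (f (x u).1 - ∫ z, f z ∂π)) ^ 2
          - ∫ y, (∑' u, (if (∑ s ∈ Finset.range u, (if (y (s + 1)).2 then (1 : ℕ) else 0)) = 0
            then (1 : ℝ) else 0) * (f (y u).1 - ∫ z, f z ∂π)) ^ 2
            ∂(Kernel.trajMeasure (X := fun _ : ℕ => Ω × Bool) (ν.map (fun y : Ω => (y, true)))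
              (fun n : ℕ => κs.comap (fun h : (i : ↥(Finset.Iic n)) → Ω × Bool =>
                h ⟨n, Finset.mem_Iic.2 le_rfl⟩) (measurable_pi_apply _))))
        * ((∑' u, (if (∑ s ∈ Finset.range u, (if (x (s + 1)).2 then (1 : ℕ) else 0)) = i' + 1
          then (1 : ℝ) else 0) * (f (x u).1 - ∫ z, f z ∂π)) ^ 2
          - ∫ y, (∑' u, (if (∑ s ∈ Finset.range u, (if (y (s + 1)).2 then (1 : ℕ) else 0)) = 0
            then (1 : ℝ) else 0) * (f (y u).1 - ∫ z, f z ∂π)) ^ 2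
            ∂(Kernel.trajMeasure (X := fun _ : ℕ => Ω × Bool) (ν.map (fun y : Ω => (y, true)))
              (fun n : ℕ => κs.comap (fun h : (i : ↥(Finset.Iic n)) → Ω × Bool =>
                h ⟨n, Finset.mem_Iic.2 le_rfl⟩) (measurable_pi_apply _))))
        ∂(Kernel.trajMeasure (X := fun _ : ℕ => Ω × Bool) μs
          (fun n : ℕ => κs.comap (fun h : (i : ↥(Finset.Iic n)) → Ω × Bool =>
            h ⟨n, Finset.mem_Iic.2 le_rfl⟩) (measurable_pi_apply _))) = 0)
    ∧ (i = i' → ∫ x, ((∑' u, (if (∑ s ∈ Finset.range u, (if (x (s + 1)).2 then (1 : ℕ) else 0))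
          = i + 1 then (1 : ℝ) else 0) * (f (x u).1 - ∫ z, f z ∂π)) ^ 2
          - ∫ y, (∑' u, (if (∑ s ∈ Finset.range u, (if (y (s + 1)).2 then (1 : ℕ) else 0)) = 0
            then (1 : ℝ) else 0) * (f (y u).1 - ∫ z, f z ∂π)) ^ 2
            ∂(Kernel.trajMeasure (X := fun _ : ℕ => Ω × Bool) (ν.map (fun y : Ω => (y, true)))
              (fun n : ℕ => κs.comap (fun h : (i : ↥(Finset.Iic n)) → Ω × Bool =>
                h ⟨n, Finset.mem_Iic.2 le_rfl⟩) (measurable_pi_apply _))))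
        * ((∑' u, (if (∑ s ∈ Finset.range u, (if (x (s + 1)).2 then (1 : ℕ) else 0)) = i' + 1
          then (1 : ℝ) else 0) * (f (x u).1 - ∫ z, f z ∂π)) ^ 2
          - ∫ y, (∑' u, (if (∑ s ∈ Finset.range u, (if (y (s + 1)).2 then (1 : ℕ) else 0)) = 0
            then (1 : ℝ) else 0) * (f (y u).1 - ∫ z, f z ∂π)) ^ 2
            ∂(Kernel.trajMeasure (X := fun _ : ℕ => Ω × Bool) (ν.map (fun y : Ω => (y, true)))
              (fun n : ℕ => κs.comap (fun h : (i : ↥(Finset.Iic n)) → Ω × Bool =>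
                h ⟨n, Finset.mem_Iic.2 le_rfl⟩) (measurable_pi_apply _))))
        ∂(Kernel.trajMeasure (X := fun _ : ℕ => Ω × Bool) μs
          (fun n : ℕ => κs.comap (fun h : (i : ↥(Finset.Iic n)) → Ω × Bool =>
            h ⟨n, Finset.mem_Iic.2 le_rfl⟩) (measurable_pi_apply _)))
        ≤ (2 * C) ^ 4 * (24 / ε.toReal ^ 4)) := by
  haveI hνt : IsProbabilityMeasure (ν.map (fun y : Ω => (y, true))) :=
    Measure.isProbabilityMeasure_map (measurable_tagCoin true).aemeasurable
  set P := Kernel.trajMeasure (X := fun _ : ℕ => Ω × Bool) μs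
      (fun n : ℕ => κs.comap (fun h : (i : ↥(Finset.Iic n)) → Ω × Bool =>
        h ⟨n, Finset.mem_Iic.2 le_rfl⟩) (measurable_pi_apply _)) with hP
  set Pν := Kernel.trajMeasure (X := fun _ : ℕ => Ω × Bool) (ν.map (fun y : Ω => (y, true)))
      (fun n : ℕ => κs.comap (fun h : (i : ↥(Finset.Iic n)) → Ω × Bool =>
        h ⟨n, Finset.mem_Iic.2 le_rfl⟩) (measurable_pi_apply _)) with hPν
  obtain ⟨hg, hCg, -⟩ := centred_observable_bounds π hf hC
  set c := ∫ z, f z ∂π with hc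
  set v := ∫ y, (∑' u, (if (∑ s ∈ Finset.range u, (if (y (s + 1)).2 then (1 : ℕ) else 0)) = 0
      then (1 : ℝ) else 0) * (f (y u).1 - c)) ^ 2 ∂Pν with hv
  have hψ : Measurable fun pq : (Ω × Bool) × (Ω × Bool) => f pq.1.1 - c :=
    hg.comp (measurable_fst.comp measurable_fst)
  -- fresh-chain input: `Z_0²` integrable
  have hZ0sqI := splitChain_integrable_sq_tourSum κs (ν.map (fun y : Ω => (y, true))) (κ := κ)
    (ν := ν) (hmin := hmin) hε0 hε hκs hg hCg 0
  rw [← hPν] at hZ0sqI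
  -- the diagonal: `E[Z_{k+1}²] = v`, `E[Z_{k+1}⁴] ≤ (2C)⁴ 24/e⁴`
  have hdiagI : ∀ k : ℕ, Integrable (fun x : ℕ → Ω × Bool =>
      (∑' u, (if (∑ s ∈ Finset.range u, (if (x (s + 1)).2 then (1 : ℕ) else 0)) = k + 1
        then (1 : ℝ) else 0) * (f (x u).1 - c)) ^ 2) P := fun k =>
    splitChain_tourFunctional_integrable κs μs (κ := κ) (ν := ν) (hmin := hmin) hε hκs k
      (ψ₁ := fun p _ => f p.1 - c) (ψ₂ := fun p _ => f p.1 - c) hψ hψ (Λ := fun a _ => a ^ 2)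
      (by norm_num) ((measurable_fst (α := ℝ) (β := ℝ)).pow_const 2) hZ0sqI
  have hdiagE : ∀ k : ℕ, ∫ x, (∑' u, (if (∑ s ∈ Finset.range u,
      (if (x (s + 1)).2 then (1 : ℕ) else 0)) = k + 1 then (1 : ℝ) else 0) * (f (x u).1 - c)) ^ 2 ∂P
      = v := fun k =>
    splitChain_tour_identically_distributed κs μs (κ := κ) (ν := ν) (hmin := hmin) hε0 hε hκs k
      (ψ₁ := fun p _ => f p.1 - c) (ψ₂ := fun p _ => f p.1 - c) hψ hψ (Λ := fun a _ => a ^ 2)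
      (by norm_num) ((measurable_fst (α := ℝ) (β := ℝ)).pow_const 2) hZ0sqI
  have h4 := fun k => splitChain_pow_four_tourSum_le κs μs (κ := κ) (ν := ν) (hmin := hmin) hε0 hε
    hκs hg hCg k
  -- off-diagonal: cross moments of squares factorise
  have hcross : ∀ k k' : ℕ, k < k' → Integrable (fun x : ℕ → Ω × Bool =>
      (∑' u, (if (∑ s ∈ Finset.range u, (if (x (s + 1)).2 then (1 : ℕ) else 0)) = k + 1
        then (1 : ℝ) else 0) * (f (x u).1 - c)) ^ 2
      * (∑' u, (if (∑ s ∈ Finset.range u, (if (x (s + 1)).2 then (1 : ℕ) else 0)) = k' + 1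
        then (1 : ℝ) else 0) * (f (x u).1 - c)) ^ 2) P
      ∧ ∫ x, (∑' u, (if (∑ s ∈ Finset.range u, (if (x (s + 1)).2 then (1 : ℕ) else 0)) = k + 1
        then (1 : ℝ) else 0) * (f (x u).1 - c)) ^ 2
      * (∑' u, (if (∑ s ∈ Finset.range u, (if (x (s + 1)).2 then (1 : ℕ) else 0)) = k' + 1
        then (1 : ℝ) else 0) * (f (x u).1 - c)) ^ 2 ∂P = v * v := by
    intro k k' hkk'
    obtain ⟨hI, hE⟩ := splitChain_tour_crossMoment_sq κs μs (κ := κ) (ν := ν) (hmin := hmin) hε0 hε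
      hκs hg hg hCg hCg (i := k + 1) (j := k') (by omega)
    rw [← hP] at hI hE
    refine ⟨hI, ?_⟩
    rw [hE, hdiagE k]
  -- expanding `(A − v)(B − v)`
  have key : ∀ (A B : (ℕ → Ω × Bool) → ℝ), Integrable A P → Integrable B P →
      Integrable (fun x => A x * B x) P → ∀ (vAB : ℝ), ∫ x, A x * B x ∂P = vAB →
      ∫ x, A x ∂P = v → ∫ x, B x ∂P = v →
      Integrable (fun x => (A x - v) * (B x - v)) P
        ∧ ∫ x, (A x - v) * (B x - v) ∂P = vAB - v * v := by
    intro A B hA hB hAB vAB hvAB hvA hvB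
    have h1 : Integrable (fun x => A x * B x - v * A x) P := hAB.sub (hA.const_mul v)
    have h2 : Integrable (fun x => A x * B x - v * A x - v * B x) P := h1.sub (hB.const_mul v)
    have h3 : Integrable (fun x => A x * B x - v * A x - v * B x + v * v) P :=
      h2.add (integrable_const _)
    refine ⟨h3.congr (ae_of_all _ fun x => by ring), ?_⟩
    calc ∫ x, (A x - v) * (B x - v) ∂P = ∫ x, (A x * B x - v * A x - v * B x + v * v) ∂P :=
          integral_congr_ae (ae_of_all _ fun x => by ring)
      _ = vAB - v * v := by
          rw [integral_add h2 (integrable_const _), integral_sub h1 (hB.const_mul v),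
            integral_sub hAB (hA.const_mul v), integral_const_mul, integral_const_mul,
            integral_const, probReal_univ, one_smul, hvAB, hvA, hvB]
          ring
  rcases lt_trichotomy i i' with h | h | h
  · obtain ⟨hI, hE⟩ := hcross i i' h
    obtain ⟨hInt, hval⟩ := key _ _ (hdiagI i) (hdiagI i') hI _ hE (hdiagE i) (hdiagE i')
    refine ⟨hInt, fun _ => ?_, fun heq => absurd heq (by omega)⟩
    rw [hval, sub_self]
  · subst h
    obtain ⟨h4I, h4E⟩ := h4 i
    rw [← hP] at h4I h4E
    have hsqI : Integrable (fun x : ℕ → Ω × Bool =>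
        (∑' u, (if (∑ s ∈ Finset.range u, (if (x (s + 1)).2 then (1 : ℕ) else 0)) = i + 1
          then (1 : ℝ) else 0) * (f (x u).1 - c)) ^ 2
        * (∑' u, (if (∑ s ∈ Finset.range u, (if (x (s + 1)).2 then (1 : ℕ) else 0)) = i + 1
          then (1 : ℝ) else 0) * (f (x u).1 - c)) ^ 2) P :=
      h4I.congr (ae_of_all _ fun x => by ring)
    have hsqE : ∫ x, (∑' u, (if (∑ s ∈ Finset.range u, (if (x (s + 1)).2 then (1 : ℕ) else 0))
          = i + 1 then (1 : ℝ) else 0) * (f (x u).1 - c)) ^ 2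
        * (∑' u, (if (∑ s ∈ Finset.range u, (if (x (s + 1)).2 then (1 : ℕ) else 0)) = i + 1
          then (1 : ℝ) else 0) * (f (x u).1 - c)) ^ 2 ∂P
        = ∫ x, (∑' u, (if (∑ s ∈ Finset.range u, (if (x (s + 1)).2 then (1 : ℕ) else 0)) = i + 1
          then (1 : ℝ) else 0) * (f (x u).1 - c)) ^ 4 ∂P :=
      integral_congr_ae (ae_of_all _ fun x => by ring)
    obtain ⟨hInt, hval⟩ := key _ _ (hdiagI i) (hdiagI i) hsqI _ hsqE (hdiagE i) (hdiagE i)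
    refine ⟨hInt, fun hne => absurd rfl hne, fun _ => ?_⟩
    rw [hval]
    have hvv : 0 ≤ v * v := mul_self_nonneg v
    linarith
  · obtain ⟨hI, hE⟩ := hcross i' i h
    have hI' := hI.congr (ae_of_all _ fun x => mul_comm _ _)
    have hE' := (integral_congr_ae (ae_of_all _ fun x => mul_comm _ _)).trans hE
    obtain ⟨hInt, hval⟩ := key _ _ (hdiagI i) (hdiagI i') hI' _ hE' (hdiagE i) (hdiagE i')
    refine ⟨hInt, fun _ => ?_, fun heq => absurd heq (by omega)⟩
    rw [hval, sub_self]

/-- **THE ORACLE REGENERATIVE VARIANCE ESTIMATOR IS CONSISTENT (CLT-free).**  `κ(x, ·) ≥ ε ν`,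
`0 < ε < 1`, `|f| ≤ C` measurable, any initial law, `R ≥ 1`, `a > 0`; with `Z_i` the centred tour
sums (centred at `π(f)` for any probability law `π`) and `v = E_{P̂_ν̂}[Z_0²]`:
`P(a ≤ |(Σ_{i=1}^R Z_i²)/R − v|) ≤ (2C)⁴ · 24 / (e⁴ a² R)`. -/
theorem regenerative_variance_oracle_confidence {π : Measure Ω} [IsProbabilityMeasure π]
    (hε0 : 0 < ε) (hε : ε < 1)
    (hκs : ∀ p, κs p = (ε • ν).map (fun y : Ω => (y, true))
      + ((1 - ε) • Doeblin.residualKernel κ ν ε hmin p.1).map (fun y : Ω => (y, false)))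
    {f : Ω → ℝ} (hf : Measurable f) {C : ℝ} (hC : ∀ x, |f x| ≤ C) {R : ℕ} (hR : 0 < R)
    {a : ℝ} (ha : 0 < a) :
    (Kernel.trajMeasure (X := fun _ : ℕ => Ω × Bool) μs
        (fun n : ℕ => κs.comap (fun h : (i : ↥(Finset.Iic n)) → Ω × Bool =>
          h ⟨n, Finset.mem_Iic.2 le_rfl⟩) (measurable_pi_apply _))).real
      {x | a ≤ |(∑ i ∈ Finset.range R, (∑' u, (if (∑ s ∈ Finset.range u,
            (if (x (s + 1)).2 then (1 : ℕ) else 0)) = i + 1 then (1 : ℝ) else 0)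
            * (f (x u).1 - ∫ z, f z ∂π)) ^ 2) / R
          - ∫ y, (∑' u, (if (∑ s ∈ Finset.range u, (if (y (s + 1)).2 then (1 : ℕ) else 0)) = 0
            then (1 : ℝ) else 0) * (f (y u).1 - ∫ z, f z ∂π)) ^ 2
            ∂(Kernel.trajMeasure (X := fun _ : ℕ => Ω × Bool) (ν.map (fun y : Ω => (y, true)))
              (fun n : ℕ => κs.comap (fun h : (i : ↥(Finset.Iic n)) → Ω × Bool =>
                h ⟨n, Finset.mem_Iic.2 le_rfl⟩) (measurable_pi_apply _)))|}
      ≤ (2 * C) ^ 4 * 24 / (ε.toReal ^ 4 * a ^ 2 * R) := by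
  haveI hνt : IsProbabilityMeasure (ν.map (fun y : Ω => (y, true))) :=
    Measure.isProbabilityMeasure_map (measurable_tagCoin true).aemeasurable
  set P := Kernel.trajMeasure (X := fun _ : ℕ => Ω × Bool) μs
      (fun n : ℕ => κs.comap (fun h : (i : ↥(Finset.Iic n)) → Ω × Bool =>
        h ⟨n, Finset.mem_Iic.2 le_rfl⟩) (measurable_pi_apply _)) with hP
  set c := ∫ z, f z ∂π with hc
  set v := ∫ y, (∑' u, (if (∑ s ∈ Finset.range u, (if (y (s + 1)).2 then (1 : ℕ) else 0)) = 0
      then (1 : ℝ) else 0) * (f (y u).1 - c)) ^ 2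
      ∂(Kernel.trajMeasure (X := fun _ : ℕ => Ω × Bool) (ν.map (fun y : Ω => (y, true)))
        (fun n : ℕ => κs.comap (fun h : (i : ↥(Finset.Iic n)) → Ω × Bool =>
          h ⟨n, Finset.mem_Iic.2 le_rfl⟩) (measurable_pi_apply _))) with hv
  have he0 : 0 < ε.toReal := ENNReal.toReal_pos hε0.ne' (ne_top_of_lt hε)
  have hR0 : (0 : ℝ) < R := Nat.cast_pos.2 hR
  obtain ⟨hg, -, -⟩ := centred_observable_bounds π hf hC
  have hψ : Measurable fun pq : (Ω × Bool) × (Ω × Bool) => f pq.1.1 - c :=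
    hg.comp (measurable_fst.comp measurable_fst)
  have hU := fun i i' => splitChain_sqCentredTourSum_uncorrelated κs μs (κ := κ) (ν := ν)
    (hmin := hmin) (π := π) hε0 hε hκs hf hC i i'
  obtain ⟨hWsqI, hWsq⟩ := integral_sq_sum_le_of_uncorrelated P
    (fun i x => (∑' u, (if (∑ s ∈ Finset.range u, (if (x (s + 1)).2 then (1 : ℕ) else 0)) = i + 1
      then (1 : ℝ) else 0) * (f (x u).1 - c)) ^ 2 - v) R (v := (2 * C) ^ 4 * (24 / ε.toReal ^ 4))
    (fun i _ i' _ => (hU i i').1) (fun i _ i' _ hne => (hU i i').2.1 hne) (fun i _ => (hU i i).2.2 rfl)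
  have hWm : ∀ i, Measurable fun x : ℕ → Ω × Bool => (∑' u, (if (∑ s ∈ Finset.range u,
      (if (x (s + 1)).2 then (1 : ℕ) else 0)) = i + 1 then (1 : ℝ) else 0) * (f (x u).1 - c)) ^ 2 - v :=
    fun i => ((measurable_tourSum (Ω := Ω) (ψ := fun p _ => f p.1 - c) hψ (i + 1)).pow_const 2).sub_const v
  have hmem : MemLp (fun x : ℕ → Ω × Bool => ∑ i ∈ Finset.range R, ((∑' u, (if (∑ s ∈ Finset.range u,
      (if (x (s + 1)).2 then (1 : ℕ) else 0)) = i + 1 then (1 : ℝ) else 0) * (f (x u).1 - c)) ^ 2 - v))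
      2 P :=
    (memLp_two_iff_integrable_sq (Finset.aestronglyMeasurable_fun_sum _ fun i _ =>
      (hWm i).aestronglyMeasurable)).2 hWsqI
  have haR : 0 < a * R := mul_pos ha hR0
  have hCheb : P.real {x : ℕ → Ω × Bool | a * R ≤ |∑ i ∈ Finset.range R, ((∑' u,
      (if (∑ s ∈ Finset.range u, (if (x (s + 1)).2 then (1 : ℕ) else 0)) = i + 1
        then (1 : ℝ) else 0) * (f (x u).1 - c)) ^ 2 - v)|}
      ≤ (∫ x, (∑ i ∈ Finset.range R, ((∑' u, (if (∑ s ∈ Finset.range u,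
          (if (x (s + 1)).2 then (1 : ℕ) else 0)) = i + 1 then (1 : ℝ) else 0) * (f (x u).1 - c)) ^ 2
          - v)) ^ 2 ∂P) / (a * R) ^ 2 := by
    simpa only [sub_zero] using measureReal_abs_sub_ge_le hmem 0 haR
  have hincl : {x : ℕ → Ω × Bool | a ≤ |(∑ i ∈ Finset.range R, (∑' u, (if (∑ s ∈ Finset.range u,
        (if (x (s + 1)).2 then (1 : ℕ) else 0)) = i + 1 then (1 : ℝ) else 0) * (f (x u).1 - c)) ^ 2)
        / R - v|}
      ⊆ {x : ℕ → Ω × Bool | a * R ≤ |∑ i ∈ Finset.range R, ((∑' u, (if (∑ s ∈ Finset.range u,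
        (if (x (s + 1)).2 then (1 : ℕ) else 0)) = i + 1 then (1 : ℝ) else 0) * (f (x u).1 - c)) ^ 2
        - v)|} := by
    intro x hx
    simp only [Set.mem_setOf_eq] at hx ⊢
    rw [Finset.sum_sub_distrib, Finset.sum_const, Finset.card_range, nsmul_eq_mul]
    set S := ∑ i ∈ Finset.range R, (∑' u, (if (∑ s ∈ Finset.range u,
      (if (x (s + 1)).2 then (1 : ℕ) else 0)) = i + 1 then (1 : ℝ) else 0) * (f (x u).1 - c)) ^ 2
    have h1 : S - R * v = (S / R - v) * R := by field_simp
    rw [h1, abs_mul, abs_of_pos hR0]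
    exact mul_le_mul_of_nonneg_right hx hR0.le
  calc P.real _ ≤ P.real _ := ENNReal.toReal_mono (measure_ne_top _ _) (measure_mono hincl)
    _ ≤ _ := hCheb
    _ ≤ (R * ((2 * C) ^ 4 * (24 / ε.toReal ^ 4))) / (a * R) ^ 2 :=
        div_le_div_of_nonneg_right hWsq (by positivity)
    _ = (2 * C) ^ 4 * 24 / (ε.toReal ^ 4 * a ^ 2 * R) := by
        field_simp

/-- **… AND ITS TARGET IS THE ASYMPTOTIC VARIANCE**: for `π` invariant, with
`σ²_f := ∫ f̄² dπ + 2 ∑' k, ∫ f̄ (kop κ)^[k+1] f̄ dπ` the Green–Kubo asymptotic variance,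
`P(a ≤ |e · (Σ_{i=1}^R Z_i²)/R − σ²_f|) ≤ (2C)⁴ · 24 / (e² a² R)` — `(ε/R) Σ Z_i²` estimates `σ²_f`
consistently, for every minorising law. -/
theorem regenerative_asymptoticVariance_oracle_confidence {π : Measure Ω} [IsProbabilityMeasure π]
    (hπ : Kernel.Invariant κ π) (hε0 : 0 < ε) (hε : ε < 1)
    (hκs : ∀ p, κs p = (ε • ν).map (fun y : Ω => (y, true))
      + ((1 - ε) • Doeblin.residualKernel κ ν ε hmin p.1).map (fun y : Ω => (y, false)))
    {f : Ω → ℝ} (hf : Measurable f) {C : ℝ} (hC : ∀ x, |f x| ≤ C) {R : ℕ} (hR : 0 < R)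
    {a : ℝ} (ha : 0 < a) :
    (Kernel.trajMeasure (X := fun _ : ℕ => Ω × Bool) μs
        (fun n : ℕ => κs.comap (fun h : (i : ↥(Finset.Iic n)) → Ω × Bool =>
          h ⟨n, Finset.mem_Iic.2 le_rfl⟩) (measurable_pi_apply _))).real
      {x | a ≤ |ε.toReal * ((∑ i ∈ Finset.range R, (∑' u, (if (∑ s ∈ Finset.range u,
            (if (x (s + 1)).2 then (1 : ℕ) else 0)) = i + 1 then (1 : ℝ) else 0)
            * (f (x u).1 - ∫ z, f z ∂π)) ^ 2) / R)
          - ((∫ y, (f y - ∫ z, f z ∂π) ^ 2 ∂π)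
            + 2 * ∑' k, ∫ y, (f y - ∫ z, f z ∂π)
              * (kop κ)^[k + 1] (fun y => f y - ∫ z, f z ∂π) y ∂π)|}
      ≤ (2 * C) ^ 4 * 24 / (ε.toReal ^ 2 * a ^ 2 * R) := by
  have he0 : 0 < ε.toReal := ENNReal.toReal_pos hε0.ne' (ne_top_of_lt hε)
  have hGK := splitChain_fresh_sq_centredTourSum_eq_greenKubo κs (κ := κ) (ν := ν) (hmin := hmin) hπ
    hε0 hε hκs hf hC
  have h := regenerative_variance_oracle_confidence κs μs (κ := κ) (ν := ν) (hmin := hmin) (π := π)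
    hε0 hε hκs hf hC hR (a := a / ε.toReal) (div_pos ha he0)
  rw [← hGK]
  have hset : ∀ x : ℕ → Ω × Bool, (a ≤ |ε.toReal * ((∑ i ∈ Finset.range R, (∑' u, (if (∑ s ∈ Finset.range u,
        (if (x (s + 1)).2 then (1 : ℕ) else 0)) = i + 1 then (1 : ℝ) else 0)
        * (f (x u).1 - ∫ z, f z ∂π)) ^ 2) / R)
      - ε.toReal * ∫ y, (∑' u, (if (∑ s ∈ Finset.range u, (if (y (s + 1)).2 then (1 : ℕ) else 0)) = 0
          then (1 : ℝ) else 0) * (f (y u).1 - ∫ z, f z ∂π)) ^ 2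
          ∂(Kernel.trajMeasure (X := fun _ : ℕ => Ω × Bool) (ν.map (fun y : Ω => (y, true)))
            (fun n : ℕ => κs.comap (fun h : (i : ↥(Finset.Iic n)) → Ω × Bool =>
              h ⟨n, Finset.mem_Iic.2 le_rfl⟩) (measurable_pi_apply _)))|)
      ↔ (a / ε.toReal ≤ |(∑ i ∈ Finset.range R, (∑' u, (if (∑ s ∈ Finset.range u,
        (if (x (s + 1)).2 then (1 : ℕ) else 0)) = i + 1 then (1 : ℝ) else 0)
        * (f (x u).1 - ∫ z, f z ∂π)) ^ 2) / R
      - ∫ y, (∑' u, (if (∑ s ∈ Finset.range u, (if (y (s + 1)).2 then (1 : ℕ) else 0)) = 0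
          then (1 : ℝ) else 0) * (f (y u).1 - ∫ z, f z ∂π)) ^ 2
          ∂(Kernel.trajMeasure (X := fun _ : ℕ => Ω × Bool) (ν.map (fun y : Ω => (y, true)))
            (fun n : ℕ => κs.comap (fun h : (i : ↥(Finset.Iic n)) → Ω × Bool =>
              h ⟨n, Finset.mem_Iic.2 le_rfl⟩) (measurable_pi_apply _)))|) := by
    intro x
    rw [← mul_sub, abs_mul, abs_of_pos he0, div_le_iff₀ he0, mul_comm]
  have hseteq : {x : ℕ → Ω × Bool | a ≤ |ε.toReal * ((∑ i ∈ Finset.range R, (∑' u, (if (∑ s ∈ Finset.range u,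
        (if (x (s + 1)).2 then (1 : ℕ) else 0)) = i + 1 then (1 : ℝ) else 0)
        * (f (x u).1 - ∫ z, f z ∂π)) ^ 2) / R)
      - ε.toReal * ∫ y, (∑' u, (if (∑ s ∈ Finset.range u, (if (y (s + 1)).2 then (1 : ℕ) else 0)) = 0
          then (1 : ℝ) else 0) * (f (y u).1 - ∫ z, f z ∂π)) ^ 2
          ∂(Kernel.trajMeasure (X := fun _ : ℕ => Ω × Bool) (ν.map (fun y : Ω => (y, true)))
            (fun n : ℕ => κs.comap (fun h : (i : ↥(Finset.Iic n)) → Ω × Bool =>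
              h ⟨n, Finset.mem_Iic.2 le_rfl⟩) (measurable_pi_apply _)))|}
      = {x : ℕ → Ω × Bool | a / ε.toReal ≤ |(∑ i ∈ Finset.range R, (∑' u, (if (∑ s ∈ Finset.range u,
        (if (x (s + 1)).2 then (1 : ℕ) else 0)) = i + 1 then (1 : ℝ) else 0)
        * (f (x u).1 - ∫ z, f z ∂π)) ^ 2) / R
      - ∫ y, (∑' u, (if (∑ s ∈ Finset.range u, (if (y (s + 1)).2 then (1 : ℕ) else 0)) = 0
          then (1 : ℝ) else 0) * (f (y u).1 - ∫ z, f z ∂π)) ^ 2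
          ∂(Kernel.trajMeasure (X := fun _ : ℕ => Ω × Bool) (ν.map (fun y : Ω => (y, true)))
            (fun n : ℕ => κs.comap (fun h : (i : ↥(Finset.Iic n)) → Ω × Bool =>
              h ⟨n, Finset.mem_Iic.2 le_rfl⟩) (measurable_pi_apply _)))|} :=
    Set.ext fun x => hset x
  rw [hseteq]
  refine h.trans (le_of_eq ?_)
  field_simp

end Oracle

end Summit.Ventures.LatticeQCDFlow.Scoring

end
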